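import Summits.CriticalPhenomena.PercolationContinuityZ3.Theorems.PercNearOneGluingNoHeavyQuantHeavyMixClosure
import HarnessLib

/-!
# QUANT lane R8, T-DEC, leg (III), general second factor — SINGLE-GATE FORM: `WindowMixDEC ⟹ LawDec.SingleGateConvClosed` for every
# heavy-decomposable second factor IN THE CONJECTURE'S OWN BINDER (one gate `q`, floor `y`, `gate_q μ₁` top-affordable and DEC at every layer);
# unconditional for a gapped first factor

builds on p205010 (kernel theorem, internal audit signed; external expert review pending)

Support file (`--supports stmt-CriticalPhenomena-4575`), QUANT lane seat prim-quant-arm-2 (gen 35), rung R8 of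
`run/shared/lean/prim/quant/LADDER.md`.  Theorems only, standard axioms, no sorries, no definitions.  Companion of this seat's
`…QuantHeavyMixClosure` (the `SDECUpTo` form: all gates `q ≤ Q`).  `LawDec.SingleGateConvClosed` (lead g28, `…QuantSingleGateClosure`) assumes the
datum of `gate_q μ₁` at ONE gate `q` only, which is weaker than `SDECUpTo`; but every ingredient of the heavy-mixture reduction is PER GATE — typer
g26's `decAt_gatedShift_succ`, lead g31's CW corollary, typer g27's move lemma, `decAtT_finite_mixture` — so the reduction re-runs verbatim with the
single-gate datum `∀ j′ < M, DECAt (q·x) j′ M (gate μ q)`.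

* `decAtT_gate_of_allLayers`, `decAt_gatedShift_one_allLayers`, **`decAt_gatedShift_allLayers`** (Conjecture R at one gate: the single-gate datum of
  `μ` at every layer gives that of `μ(· − k)`), **`decAt_slice_of_windowMix_gate`** (CW ⟹ the single-gate blob step), **`decAt_slice_of_gap_gate`**
  (unconditional blob step beside a gapped law, one gate).
* **`decAt_lconv_twoPointMix_gate`** — single-gate master lemma.
* **`singleGateConvClosed_heavyMix_of_windowMix : WindowMixDEC → …`** — for `0 < y < 1`, `0 < q ≤ 1`, `μ₁` with EXACTLY the hypotheses of
  `SingleGateConvClosed` (probability law on `{0..M₁}`, `y·M₁ ≤ q·ΣT`, `gate_q μ₁` DEC at every `j′ < M₁` at floor `y`) and `μ₂` ANY finite mixture of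
  common-mean two-point laws on `{0..M₂}` with heavy gates `y ≤ q·γ i`: `gate_q(μ₁ ∗ μ₂)` is DEC at every `j′ < M₁ + M₂` at floor `y` — the conclusion
  of `SingleGateConvClosed`, no hypothesis on `gate_q μ₂` needed.  CONDITIONAL on CW.
* **`singleGateConvClosed_heavyMix_of_gap`** — the same UNCONDITIONALLY when `μ₁` has no atom strictly inside `(0, A)` and the blob sizes are `≤ A`.
HONEST STATUS: `WindowMixDEC`, `GatedSliceMixLaw'`, `SingleGateConvClosed`, `GatedConvEmptyFree`, `TreeDEC`, `FarTreeRow` remain OPEN; the RATE class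
log\* and the honest sentence of `run/shared/lean/prim/quant/README.md` are unchanged.

[this work]; gated shift: prim-quant-stmt g26; CW corollary: prim-quant-lead g31; move lemma: prim-quant-stmt g27; `SingleGateConvClosed`: prim-quant-lead
g28 (this lane).  Nothing here is cited as a published result.  The gluing rows served [cite: KozmaNitzan2024, Conjecture 3 (p. 15)]; product measure
[cite: Grimmett1999, §1.3 p. 10].
-/

noncomputable section

namespace Summit.CriticalPhenomena.PercolationContinuityZ3.Theorems

namespace Quant

open Finset

/-- the two-point law `{lo, hi; g}` (as in `…QuantLawDEC`) -/
local notation3 "TP[" lo ", " hi ", " g ", " h "]" =>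
  (g : ℝ) * (if (h : ℕ) = (hi : ℕ) then (1 : ℝ) else 0) + (1 - (g : ℝ)) * (if (h : ℕ) = (lo : ℕ) then (1 : ℝ) else 0)

namespace LawDec

/-! ### Single-gate tools: the hypotheses of `SingleGateConvClosed` concern ONE gate `q`; every ingredient of the heavy-mixture reduction is
per-gate, so we re-run it with the single-gate datum `∀ j′ < M, DECAt (q·x) j′ M (gate μ q)` in place of `SDECUpTo`. -/

/-- single gate, from the datum below the top to `DECAtT` at every layer on any larger declared top (Theorem A above the top). [this work] -/
theorem decAtT_gate_of_allLayers (x q : ℝ) (N M' j : ℕ) (Λ : ℕ → ℝ) (hx0 : 0 < x) (hq0 : 0 < q) (hq1 : q ≤ 1) (hqx : q * x < 1)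
    (hΛ0 : ∀ h, 0 ≤ Λ h) (hΛN : ∀ h, N < h → Λ h = 0) (hΛ1 : ∑ h ∈ Finset.range (N + 1), Λ h = 1)
    (hta : x * (N : ℝ) ≤ ∑ h ∈ Finset.range (N + 1), (h : ℝ) * Λ h) (hD : ∀ j', j' < N → DECAt (q * x) j' N (gate Λ q))
    (hNM : N ≤ M') :
    DECAtT (q * x) (q * ∑ h ∈ Finset.range (N + 1), (h : ℝ) * Λ h) j M' (gate Λ q) := by
  obtain ⟨n0, nN, n1⟩ := gate_laws N Λ q hq0.le hq1 hΛ0 hΛN hΛ1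
  have nmean : ∑ h ∈ Finset.range (N + 1), (h : ℝ) * gate Λ q h = q * ∑ h ∈ Finset.range (N + 1), (h : ℝ) * Λ h :=
    sum_mul_gate Λ q N
  refine decAtT_mono_top ?_ hNM
  by_cases hjN : j < N
  · have h := hD j hjN
    rwa [decAt_iff_decAtT, nmean] at h
  · have htop : ∀ h, 0 < gate Λ q h → q * x * (h : ℝ) ≤ ∑ k ∈ Finset.range (N + 1), (k : ℝ) * gate Λ q k := by
      intro h hh
      have hhN : h ≤ N := by
        by_contra hc
        exact (ne_of_gt hh) (nN h (not_le.1 hc))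
      rw [nmean]
      have h1 : q * x * (h : ℝ) ≤ q * x * N :=
        mul_le_mul_of_nonneg_left (by exact_mod_cast hhN) (mul_pos hq0 hx0).le
      have h2 : q * (x * (N : ℝ)) ≤ q * ∑ k ∈ Finset.range (N + 1), (k : ℝ) * Λ k := mul_le_mul_of_nonneg_left hta hq0.le
      linarith
    have h := decAt_of_top_le N (gate Λ q) n0 nN n1 (q * x) hqx htop j (not_lt.1 hjN)
    rwa [decAt_iff_decAtT, nmean] at h

/-- **single-gate gated shift by one** (typer g26's `decAt_gatedShift_succ` at every layer, plus the layer `0`). [this work] -/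
theorem decAt_gatedShift_one_allLayers (x q : ℝ) (M : ℕ) (μ : ℕ → ℝ) (hx0 : 0 < x) (hx1 : x ≤ 1) (hq0 : 0 < q) (hq1 : q ≤ 1)
    (hqx : q * x < 1) (hμ0 : ∀ h, 0 ≤ μ h) (hμM : ∀ h, M < h → μ h = 0) (hμ1 : ∑ h ∈ Finset.range (M + 1), μ h = 1)
    (hta : x * (M : ℝ) ≤ ∑ h ∈ Finset.range (M + 1), (h : ℝ) * μ h) (hD : ∀ j', j' < M → DECAt (q * x) j' M (gate μ q)) :
    ∀ j, j < M + 1 → DECAt (q * x) j (M + 1) (gate (fun t => if 1 ≤ t then μ (t - 1) else 0) q) := by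
  intro j hj
  set y : ℝ := q * x with hy
  have hy0 : 0 < y := mul_pos hq0 hx0
  by_cases hj0 : j = 0
  · -- layer 0: the gate-zero rides the giants
    subst hj0
    obtain ⟨L0, LM, L1, -, hL00, -⟩ := gate_shift_laws q M μ (fun t => if 1 ≤ t then μ (t - 1) else 0) hq0.le hq1 hμ0 hμM hμ1
      (fun t => rfl)
    refine decAt_of_giantsAbsorbLows y 0 (M + 1) _ hj L0 LM L1 hy0 ?_
    have hlows : ∑ h ∈ Finset.range (0 + 1),
        (if 2 * (h : ℝ) < ∑ k ∈ Finset.range (M + 1 + 1), (k : ℝ) * gate (fun t => if 1 ≤ t then μ (t - 1) else 0) q k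
          then gate (fun t => if 1 ≤ t then μ (t - 1) else 0) q h else 0) ≤ 1 - q := by
      rw [zero_add, Finset.sum_range_one]
      split_ifs
      · exact le_of_eq hL00
      · linarith
    have hgiants : ∑ h ∈ Finset.Ico (0 + 1) (M + 1 + 1), gate (fun t => if 1 ≤ t then μ (t - 1) else 0) q h = q := by
      have := Finset.sum_range_add_sum_Ico (gate (fun t => if 1 ≤ t then μ (t - 1) else 0) q)
        (show 0 + 1 ≤ M + 1 + 1 by omega)
      rw [L1, zero_add, Finset.sum_range_one, hL00] at this
      linarith
    rw [hgiants]
    have hyq : y ≤ q := mul_le_of_le_one_right hq0.le hx1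
    have := mul_le_mul_of_nonneg_left hlows hy0.le
    nlinarith
  · obtain ⟨J, rfl⟩ : ∃ J, j = J + 1 := ⟨j - 1, by omega⟩
    exact decAt_gatedShift_succ x q J M μ hx0 hx1 hq0 hq1 hqx hμ0 hμM hμ1 hta (by omega) (hD J (by omega))

/-- **single-gate gated shift by `k` relays**: the single-gate datum of `μ` at every layer gives that of `μ(· − k)`. [this work] -/
theorem decAt_gatedShift_allLayers (x q : ℝ) (k M : ℕ) (μ : ℕ → ℝ) (hx0 : 0 < x) (hx1 : x ≤ 1) (hq0 : 0 < q) (hq1 : q ≤ 1)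
    (hqx : q * x < 1) (hμ0 : ∀ h, 0 ≤ μ h) (hμM : ∀ h, M < h → μ h = 0) (hμ1 : ∑ h ∈ Finset.range (M + 1), μ h = 1)
    (hta : x * (M : ℝ) ≤ ∑ h ∈ Finset.range (M + 1), (h : ℝ) * μ h) (hD : ∀ j', j' < M → DECAt (q * x) j' M (gate μ q)) :
    ∀ j, j < k + M → DECAt (q * x) j (k + M) (gate (fun t => if k ≤ t then μ (t - k) else 0) q) := by
  induction k with
  | zero =>
    intro j hj
    have e : (fun t => if 0 ≤ t then μ (t - 0) else 0) = μ := by funext t; simp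
    rw [e, Nat.zero_add]; exact hD j (by omega)
  | succ n ih =>
    obtain ⟨s0, sM, s1, smean⟩ := shift_laws n M μ hμ0 hμM hμ1
    have hta' : x * ((n + M : ℕ) : ℝ) ≤ ∑ t ∈ Finset.range (n + M + 1), (t : ℝ) * (fun t => if n ≤ t then μ (t - n) else 0) t := by
      rw [smean]; push_cast; nlinarith
    have h1 := decAt_gatedShift_one_allLayers x q (n + M) (fun t => if n ≤ t then μ (t - n) else 0) hx0 hx1 hq0 hq1 hqx s0 sM s1
      hta' ih
    have e : (fun t => if 1 ≤ t then (fun t => if n ≤ t then μ (t - n) else 0) (t - 1) else 0)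
        = fun t => if n + 1 ≤ t then μ (t - (n + 1)) else 0 := by
      funext t
      beta_reduce
      by_cases ht : n + 1 ≤ t
      · rw [if_pos ht, if_pos (by omega), if_pos (by omega), show t - 1 - n = t - (n + 1) by omega]
      · rw [if_neg ht]
        by_cases h1 : 1 ≤ t
        · rw [if_pos h1, if_neg (by omega)]
        · rw [if_neg h1]
    rw [e, show n + M + 1 = n + 1 + M by omega] at h1
    exact h1

/-- **single-gate blob step from CW**: `WindowMixDEC` and the single-gate datum of `μ` at every layer give the single-gate datum of
`slice μ a g` for a heavy blob `x ≤ g ≤ 1` (lead g31's `sdecUpTo_slice_of_windowMix`, one gate). CONDITIONAL on CW. [this work] -/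
theorem decAt_slice_of_windowMix_gate (hCW : WindowMixDEC) (x q g : ℝ) (a M : ℕ) (μ : ℕ → ℝ) (hx0 : 0 < x)
    (hq0 : 0 < q) (hq1 : q ≤ 1) (hqx : q * x < 1) (hxg : x ≤ g) (hg1 : g ≤ 1) (ha : 1 ≤ a)
    (hμ0 : ∀ h, 0 ≤ μ h) (hμM : ∀ h, M < h → μ h = 0) (hμ1 : ∑ h ∈ Finset.range (M + 1), μ h = 1)
    (hta : x * (M : ℝ) ≤ ∑ h ∈ Finset.range (M + 1), (h : ℝ) * μ h)
    (hD : ∀ j', j' < M → DECAt (q * x) j' M (gate μ q)) :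
    ∀ j, j < M + a → DECAt (q * x) j (M + a) (gate (slice μ a g) q) := by
  intro j hj
  set T : ℝ := ∑ h ∈ Finset.range (M + 1), (h : ℝ) * μ h with hT
  set y : ℝ := q * x with hy
  have hy0 : 0 < y := mul_pos hq0 hx0
  have hyqg : y ≤ (1 - (1 - q)) * g := by rw [hy, sub_sub_cancel]; exact mul_le_mul_of_nonneg_left hxg hq0.le
  obtain ⟨n0, nM, n1⟩ := gate_laws M μ q hq0.le hq1 hμ0 hμM hμ1
  have nmean : ∑ h ∈ Finset.range (M + 1), (h : ℝ) * gate μ q h = q * T := sum_mul_gate μ q M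
  have htaν : y * (M : ℝ) ≤ q * T := by rw [hy, mul_assoc]; exact mul_le_mul_of_nonneg_left hta hq0.le
  have hzν : 1 - q ≤ gate μ q 0 := by rw [gate_apply, if_pos rfl]; nlinarith [hμ0 0]
  have hwin : ∀ i, j ≤ i + a → i ≤ j → DECAtT y (q * T) i M (gate μ q) := by
    intro i _ _
    have h := decAtT_gate_of_allLayers x q M M i μ hx0 hq0 hq1 hqx hμ0 hμM hμ1 hta hD le_rfl
    rwa [← hT] at h
  have hcw := hCW y (1 - q) g (q * T) a j M (gate μ q) hy0 hqx (by linarith) hzν hg1 hyqg ha n0 nM n1 nmean.symm htaν hj hwin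
  have hsmean : ∑ h ∈ Finset.range (M + a + 1), (h : ℝ) * slice μ a g h = T + (a : ℝ) * g := sum_mul_slice μ a g M hμM hμ1
  rw [decAt_iff_decAtT, sum_mul_gate, hsmean, gate_slice_eq_mix, gate_shift_eq_shiftBut μ q a ha]
  convert hcw using 2
  ring

/-- **single-gate blob step for a GAPPED law** (no atom in `(0, a)`), unconditional: this seat's `sdecUpTo_slice_of_gap` at one gate. [this work] -/
theorem decAt_slice_of_gap_gate (x q g : ℝ) (a M : ℕ) (μ : ℕ → ℝ) (hx0 : 0 < x) (hq0 : 0 < q) (hq1 : q ≤ 1) (hqx : q * x < 1)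
    (hxg : x ≤ g) (hg1 : g ≤ 1) (ha : 1 ≤ a) (hμ0 : ∀ h, 0 ≤ μ h) (hμM : ∀ h, M < h → μ h = 0)
    (hμ1 : ∑ h ∈ Finset.range (M + 1), μ h = 1)
    (hta : x * (M : ℝ) ≤ ∑ h ∈ Finset.range (M + 1), (h : ℝ) * μ h)
    (hgap : ∀ k, 0 < k → k < a → μ k = 0)
    (hD : ∀ j', j' < M → DECAt (q * x) j' M (gate μ q)) :
    ∀ j, j < M + a → DECAt (q * x) j (M + a) (gate (slice μ a g) q) := by
  intro j hj
  set T : ℝ := ∑ h ∈ Finset.range (M + 1), (h : ℝ) * μ h with hT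
  set y : ℝ := q * x with hy
  have hy0 : 0 < y := mul_pos hq0 hx0
  have hy1 : y < 1 := hqx
  have hyqg : y ≤ q * g := mul_le_mul_of_nonneg_left hxg hq0.le
  have hqg1 : q * g ≤ 1 := by nlinarith
  obtain ⟨n0, nM, n1⟩ := gate_laws M μ q hq0.le hq1 hμ0 hμM hμ1
  have nmean : ∑ h ∈ Finset.range (M + 1), (h : ℝ) * gate μ q h = q * T := sum_mul_gate μ q M
  have htaν : y * (M : ℝ) ≤ q * T := by rw [hy, mul_assoc]; exact mul_le_mul_of_nonneg_left hta hq0.le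
  have hΛ : DECAtT y (q * T + (a : ℝ) * g) j (M + a) (slice (gate μ q) a g) := by
    refine sliceClosedWindowT_holds y g (q * T) M a j (gate μ q) hy0 hy1 (hyqg.trans (by nlinarith)) hg1 ha n0 nM n1
      (by omega) ?_
    intro j'' _ _
    have h := decAtT_gate_of_allLayers x q M M j'' μ hx0 hq0 hq1 hqx hμ0 hμM hμ1 hta hD le_rfl
    rwa [← hT] at h
  have hzν : 1 - q ≤ gate μ q 0 := by
    have e : gate μ q 0 = q * μ 0 + (1 - q) := by simp [gate]
    rw [e]; nlinarith [hμ0 0]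
  have hsupp : ∀ k, 0 < k → k < a → (1 - g) * gate μ q k = 0 := by
    intro k hk hka
    have e : gate μ q k = q * μ k + (if k = 0 then 1 - q else 0) := rfl
    rw [e, hgap k hk hka, if_neg (by omega)]; ring
  have hmove := decAtT_gateMoveBlob y (1 - q) g (q * T) a j M (gate μ q) hy0 hy1 (by linarith) hg1
    (by rw [hy]; nlinarith) ha n0 nM n1 nmean.symm htaν hzν hsupp hΛ
  have hlaw : (fun h => slice (gate μ q) a g h + g * (1 - q) * ((if h = 0 then (1 : ℝ) else 0) - (if h = a then (1 : ℝ) else 0)))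
      = gate (slice μ a g) q := by
    funext h
    simp only [gate, slice]
    by_cases h0 : h = 0
    · subst h0
      have hna : ¬ (a ≤ 0) := by omega
      have h0a : (0 : ℕ) ≠ a := by omega
      simp [hna, h0a]; ring
    · by_cases h1 : h = a
      · subst h1; simp [h0]; ring
      · by_cases hle : a ≤ h
        · have : h - a ≠ 0 := by omega
          simp only [if_neg h0, if_neg h1, if_pos hle, if_neg this]
          ring
        · simp only [if_neg h0, if_neg h1, if_neg hle]
          ring
  have hsmean : ∑ h ∈ Finset.range (M + a + 1), (h : ℝ) * slice μ a g h = T + (a : ℝ) * g := sum_mul_slice μ a g M hμM hμ1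
  rw [decAt_iff_decAtT, sum_mul_gate, hsmean]
  have et : q * (T + (a : ℝ) * g) = q * T + (a : ℝ) * g - (1 - q) * (a : ℝ) * g := by ring
  rw [et, ← hlaw]
  exact hmove

/-! ### The single-gate master lemma and `SingleGateConvClosed` for heavy-decomposable second factors -/

/-- **SINGLE-GATE MASTER LEMMA.**  As `sdecUpTo_lconv_twoPointMix`, with the single-gate datum of `μ₁` (`gate_q μ₁` DEC at every layer below the
top at floor `q·x`) and of each charged blob slice, concluding the single-gate datum of `lconv μ₁ μ₂` — the exact shape of the hypotheses and the
conclusion of `LawDec.SingleGateConvClosed`. [this work] -/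
theorem decAt_lconv_twoPointMix_gate (x q T₂ : ℝ) (M₁ M₂ : ℕ) (μ₁ : ℕ → ℝ) {ι : Type} [Fintype ι] (w γ : ι → ℝ) (lo hi : ι → ℕ)
    (hx0 : 0 < x) (hx1 : x ≤ 1) (hq0 : 0 < q) (hq1 : q ≤ 1) (hqx : q * x < 1)
    (hμ0 : ∀ h, 0 ≤ μ₁ h) (hμM : ∀ h, M₁ < h → μ₁ h = 0) (hμ1 : ∑ h ∈ Finset.range (M₁ + 1), μ₁ h = 1)
    (hta : x * (M₁ : ℝ) ≤ ∑ h ∈ Finset.range (M₁ + 1), (h : ℝ) * μ₁ h) (hD : ∀ j', j' < M₁ → DECAt (q * x) j' M₁ (gate μ₁ q))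
    (hw0 : ∀ i, 0 ≤ w i) (hw1 : ∑ i, w i = 1) (hγ : ∀ i, 0 ≤ γ i ∧ γ i ≤ 1) (hlohi : ∀ i, lo i ≤ hi i)
    (hhi : ∀ i, hi i ≤ M₂) (hheavy : ∀ i, 0 < w i → lo i < hi i → x ≤ γ i)
    (hmeans : ∀ i, 0 < w i → (lo i : ℝ) + ((hi i : ℝ) - lo i) * γ i = T₂)
    (hslice : ∀ i, 0 < w i → lo i < hi i →
      ∀ j, j < M₁ + (hi i - lo i) → DECAt (q * x) j (M₁ + (hi i - lo i)) (gate (slice μ₁ (hi i - lo i) (γ i)) q)) :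
    ∀ j, j < M₁ + M₂ → DECAt (q * x) j (M₁ + M₂) (gate (lconv M₁ M₂ μ₁ (fun h => ∑ i, w i * TP[lo i, hi i, γ i, h])) q) := by
  intro j hj
  set T₁ : ℝ := ∑ h ∈ Finset.range (M₁ + 1), (h : ℝ) * μ₁ h with hT₁
  obtain ⟨m0, mM, m1, mmean⟩ := twoPointMix_laws M₂ T₂ w γ lo hi hw0 hw1 hγ hlohi hhi hmeans
  rw [decAt_iff_decAtT, sum_mul_gate, sum_mul_lconv M₁ M₂ μ₁ _ hμ1 m1, mmean]
  have hmix : ∀ h, gate (lconv M₁ M₂ μ₁ (fun k => ∑ i, w i * TP[lo i, hi i, γ i, k])) q h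
      = ∑ i, w i * gate (lconv M₁ M₂ μ₁ (fun k => TP[lo i, hi i, γ i, k])) q h := by
    intro h
    rw [← gate_sum_mixture w _ q hw1 h]
    congr 1
    funext k
    exact lconv_sum_right M₁ M₂ μ₁ w (fun i k => TP[lo i, hi i, γ i, k]) k
  refine decAtT_finite_mixture (q * x) (q * (T₁ + T₂)) j (M₁ + M₂) _ w
    (fun i => gate (lconv M₁ M₂ μ₁ (fun k => TP[lo i, hi i, γ i, k])) q) hw0 hw1 hmix (fun i hi0 => ?_)
  set a : ℕ := hi i - lo i with ha
  set Λ : ℕ → ℝ := slice μ₁ a (γ i) with hΛ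
  have hΛD : ∀ j', j' < M₁ + a → DECAt (q * x) j' (M₁ + a) (gate Λ q) := by
    rcases Nat.eq_zero_or_pos a with ha0 | hapos
    · rw [hΛ, ha0, slice_zero_size, Nat.add_zero]; exact hD
    · exact hslice i hi0 (by omega)
  have Λ0 : ∀ h, 0 ≤ Λ h := slice_nonneg μ₁ a (γ i) (hγ i).1 (hγ i).2 hμ0
  have ΛM : ∀ h, M₁ + a < h → Λ h = 0 := slice_eq_zero μ₁ a (γ i) M₁ hμM
  have Λ1 : ∑ h ∈ Finset.range (M₁ + a + 1), Λ h = 1 := sum_slice μ₁ a (γ i) M₁ hμM hμ1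
  have Λmean : ∑ h ∈ Finset.range (M₁ + a + 1), (h : ℝ) * Λ h = T₁ + (a : ℝ) * γ i := sum_mul_slice μ₁ a (γ i) M₁ hμM hμ1
  have Λta : x * ((M₁ + a : ℕ) : ℝ) ≤ ∑ h ∈ Finset.range (M₁ + a + 1), (h : ℝ) * Λ h := by
    rw [Λmean]; push_cast
    rcases Nat.eq_zero_or_pos a with ha0 | hapos
    · rw [ha0]; push_cast; linarith
    · have hxγ : x ≤ γ i := hheavy i hi0 (by omega)
      nlinarith [mul_le_mul_of_nonneg_left hxγ (Nat.cast_nonneg a)]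
  set Λk : ℕ → ℝ := fun t => if lo i ≤ t then Λ (t - lo i) else 0 with hΛk
  obtain ⟨Λk0, ΛkM, Λk1, Λkmean⟩ := shift_laws (lo i) (M₁ + a) Λ Λ0 ΛM Λ1
  have hΛkD : ∀ j', j' < lo i + (M₁ + a) → DECAt (q * x) j' (lo i + (M₁ + a)) (gate Λk q) :=
    decAt_gatedShift_allLayers x q (lo i) (M₁ + a) Λ hx0 hx1 hq0 hq1 hqx Λ0 ΛM Λ1 Λta hΛD
  have Λkta : x * ((lo i + (M₁ + a) : ℕ) : ℝ) ≤ ∑ t ∈ Finset.range (lo i + (M₁ + a) + 1), (t : ℝ) * Λk t := by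
    rw [Λkmean]
    have : x * (lo i : ℝ) ≤ lo i := by nlinarith [(Nat.cast_nonneg (lo i) : (0 : ℝ) ≤ lo i)]
    push_cast at Λta ⊢
    nlinarith
  have hNM : lo i + (M₁ + a) ≤ M₁ + M₂ := by have := hhi i; have := hlohi i; omega
  have hdec := decAtT_gate_of_allLayers x q (lo i + (M₁ + a)) (M₁ + M₂) j Λk hx0 hq0 hq1 hqx Λk0 ΛkM Λk1 Λkta hΛkD hNM
  rw [Λkmean, Λmean] at hdec
  have et : q * (T₁ + (a : ℝ) * γ i + (lo i : ℝ)) = q * (T₁ + T₂) := by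
    rw [← hmeans i hi0, ha]; push_cast [Nat.cast_sub (hlohi i)]; ring
  rw [et] at hdec
  have elaw : gate (lconv M₁ M₂ μ₁ (fun k => TP[lo i, hi i, γ i, k])) q = gate Λk q := by
    rw [lconv_TP_eq_shift_slice M₁ M₂ (lo i) (hi i) μ₁ (γ i) hμM (hlohi i) (hhi i)]
  rw [elaw]
  exact hdec

/-- **`WindowMixDEC ⟹ LawDec.SingleGateConvClosed` FOR EVERY HEAVY-DECOMPOSABLE SECOND FACTOR — in the conjecture's own binder for the first
factor.**  Floor `0 < y < 1`, ONE gate `0 < q ≤ 1`, `μ₁` a probability law on `{0..M₁}` whose gated version is top-affordable at `y`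
(`y·M₁ ≤ q·ΣT`) and DEC at every layer `j′ < M₁` at floor `y` — verbatim the hypotheses of `SingleGateConvClosed` on `μ₁` —, and a second factor
`μ₂ = Σ_i w_i·{lo i, hi i; γ i}` on `{0..M₂}` that is a finite mixture of two-point laws with a common mean and HEAVY gates `y ≤ q·γ i`: then
`gate_q(μ₁ ∗ μ₂)` is DEC at every layer `j′ < M₁ + M₂` at floor `y`.  (No hypothesis on `gate_q μ₂` is needed; such a `μ₂` satisfies them anyway.)
CONDITIONAL on CW. [this work] -/
theorem singleGateConvClosed_heavyMix_of_windowMix (hCW : WindowMixDEC) (y q T₂ : ℝ) (M₁ M₂ : ℕ) (μ₁ : ℕ → ℝ) {ι : Type} [Fintype ι]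
    (w γ : ι → ℝ) (lo hi : ι → ℕ)
    (hy0 : 0 < y) (hy1 : y < 1) (hq0 : 0 < q) (hq1 : q ≤ 1)
    (hμ0 : ∀ h, 0 ≤ μ₁ h) (hμM : ∀ h, M₁ < h → μ₁ h = 0) (hμ1 : ∑ h ∈ Finset.range (M₁ + 1), μ₁ h = 1)
    (hta : y * (M₁ : ℝ) ≤ q * ∑ h ∈ Finset.range (M₁ + 1), (h : ℝ) * μ₁ h)
    (hD : ∀ j', j' < M₁ → DECAt y j' M₁ (gate μ₁ q))
    (hw0 : ∀ i, 0 ≤ w i) (hw1 : ∑ i, w i = 1) (hγ1 : ∀ i, γ i ≤ 1) (hheavy : ∀ i, y ≤ q * γ i) (hlohi : ∀ i, lo i ≤ hi i)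
    (hhi : ∀ i, hi i ≤ M₂) (hmeans : ∀ i, (lo i : ℝ) + ((hi i : ℝ) - lo i) * γ i = T₂) :
    ∀ j', j' < M₁ + M₂ → DECAt y j' (M₁ + M₂) (gate (lconv M₁ M₂ μ₁ (fun h => ∑ i, w i * TP[lo i, hi i, γ i, h])) q) := by
  set x : ℝ := y / q with hx
  have hx0 : 0 < x := div_pos hy0 hq0
  have hqx : q * x = y := by rw [hx]; field_simp
  have hxγ : ∀ i, x ≤ γ i := fun i => by rw [hx, div_le_iff₀ hq0, mul_comm]; exact hheavy i
  have hx1 : x ≤ 1 := by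
    rcases isEmpty_or_nonempty ι with hι | ⟨⟨i⟩⟩
    · simp at hw1
    · exact (hxγ i).trans (hγ1 i)
  have hta' : x * (M₁ : ℝ) ≤ ∑ h ∈ Finset.range (M₁ + 1), (h : ℝ) * μ₁ h := by
    rw [hx, div_mul_eq_mul_div, div_le_iff₀ hq0, mul_comm _ q]; exact hta
  rw [← hqx] at hD ⊢
  rw [← hqx] at hy1
  exact decAt_lconv_twoPointMix_gate x q T₂ M₁ M₂ μ₁ w γ lo hi hx0 hx1 hq0 hq1 hy1 hμ0 hμM hμ1 hta' hD hw0 hw1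
    (fun i => ⟨hx0.le.trans (hxγ i), hγ1 i⟩) hlohi hhi (fun i _ _ => hxγ i) (fun i _ => hmeans i)
    (fun i _ _ => decAt_slice_of_windowMix_gate hCW x q (γ i) (hi i - lo i) M₁ μ₁ hx0 hq0 hq1 hy1 (hxγ i) (hγ1 i) (by omega)
      hμ0 hμM hμ1 hta' hD)

/-- **UNCONDITIONAL single-gate instance: a GAPPED first factor.**  In the binder of `SingleGateConvClosed` for `μ₁`, if moreover `μ₁` has no atom
strictly inside `(0, A)` and the heavy components of `μ₂` have blob sizes `hi i − lo i ≤ A`, the conclusion of `SingleGateConvClosed` holds.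
[this work] -/
theorem singleGateConvClosed_heavyMix_of_gap (y q T₂ : ℝ) (M₁ M₂ A : ℕ) (μ₁ : ℕ → ℝ) {ι : Type} [Fintype ι]
    (w γ : ι → ℝ) (lo hi : ι → ℕ)
    (hy0 : 0 < y) (hy1 : y < 1) (hq0 : 0 < q) (hq1 : q ≤ 1)
    (hμ0 : ∀ h, 0 ≤ μ₁ h) (hμM : ∀ h, M₁ < h → μ₁ h = 0) (hμ1 : ∑ h ∈ Finset.range (M₁ + 1), μ₁ h = 1)
    (hta : y * (M₁ : ℝ) ≤ q * ∑ h ∈ Finset.range (M₁ + 1), (h : ℝ) * μ₁ h)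
    (hD : ∀ j', j' < M₁ → DECAt y j' M₁ (gate μ₁ q))
    (hgap : ∀ k, 0 < k → k < A → μ₁ k = 0)
    (hw0 : ∀ i, 0 ≤ w i) (hw1 : ∑ i, w i = 1) (hγ1 : ∀ i, γ i ≤ 1) (hheavy : ∀ i, y ≤ q * γ i) (hlohi : ∀ i, lo i ≤ hi i)
    (hhi : ∀ i, hi i ≤ M₂) (hsize : ∀ i, hi i - lo i ≤ A) (hmeans : ∀ i, (lo i : ℝ) + ((hi i : ℝ) - lo i) * γ i = T₂) :
    ∀ j', j' < M₁ + M₂ → DECAt y j' (M₁ + M₂) (gate (lconv M₁ M₂ μ₁ (fun h => ∑ i, w i * TP[lo i, hi i, γ i, h])) q) := by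
  set x : ℝ := y / q with hx
  have hx0 : 0 < x := div_pos hy0 hq0
  have hqx : q * x = y := by rw [hx]; field_simp
  have hxγ : ∀ i, x ≤ γ i := fun i => by rw [hx, div_le_iff₀ hq0, mul_comm]; exact hheavy i
  have hx1 : x ≤ 1 := by
    rcases isEmpty_or_nonempty ι with hι | ⟨⟨i⟩⟩
    · simp at hw1
    · exact (hxγ i).trans (hγ1 i)
  have hta' : x * (M₁ : ℝ) ≤ ∑ h ∈ Finset.range (M₁ + 1), (h : ℝ) * μ₁ h := by
    rw [hx, div_mul_eq_mul_div, div_le_iff₀ hq0, mul_comm _ q]; exact hta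
  rw [← hqx] at hD ⊢
  rw [← hqx] at hy1
  exact decAt_lconv_twoPointMix_gate x q T₂ M₁ M₂ μ₁ w γ lo hi hx0 hx1 hq0 hq1 hy1 hμ0 hμM hμ1 hta' hD hw0 hw1
    (fun i => ⟨hx0.le.trans (hxγ i), hγ1 i⟩) hlohi hhi (fun i _ _ => hxγ i) (fun i _ => hmeans i)
    (fun i _ _ => decAt_slice_of_gap_gate x q (γ i) (hi i - lo i) M₁ μ₁ hx0 hq0 hq1 hy1 (hxγ i) (hγ1 i) (by omega)
      hμ0 hμM hμ1 hta' (fun k hk hkA => hgap k hk (lt_of_lt_of_le hkA (hsize i))) hD)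

end LawDec

end Quant

end Summit.CriticalPhenomena.PercolationContinuityZ3.Theorems
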